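import Summits.HubbardSuperconductivity.HubbardSuperconductivity.Theorems.AnisotropyChordTransferFibre3FinX3Eval

/-!
# Route `AnisotropyChord` / H0 rotor rung: FIN per-`L` GM₃ (X5), `L = 34` — rows `N₁` / D / side-condition cell facts, part `p55`

Kernel facts (`decide +kernel`) for cert cells 130, 131 of the per-`L` grid of `L = 34`: `xbnCellAny2` (row `N₁` on XB2 point wedges recomputed in the kernel, exporting the literal brackets `nt ⊇ T⁺ − 3λ₂` and `tb ⊇ T⁺·D`), `xdCellAnyN0` (row D, reads `nt`), `sdCellAnyZN` (side condition, reads `nt`); evaluators `…FinX3Eval` / `…FinX5Eval`; constants from the compiled design probe (x3probe/x3plan, margins c ×0.985, b ×1.03, aD ×1.03); assembled in `…FinX5GM3ThirtyFour`.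
Prover seat `hubbard-h0-rotor-p3` g8; helper for piece A = stmt-HubbardSuperconductivity-23918 of rung 19089 (`--supports`, helper class).
WHAT THIS IS NOT: nothing here proves superconductivity in the Hubbard model (rotor TARGET as worded stays FALSE, g15 verdict); kernel facts for the FIN certificate of ONE conditional reduction.  Tree imports only; zero data; standard axioms.
-/

set_option linter.dupNamespace false
set_option autoImplicit false

namespace Summit.HubbardSuperconductivity.HubbardSuperconductivity.Theorems.AnisotropyChord.Transfer.Fibre3

namespace FinXD

open FinXB FinCell Hole2

set_option maxHeartbeats 4000000 in
/-- row `N₁` of cell 130 of `L = 34` (`c = 57/100`), exporting `nt`, `tb`. [folklore] -/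
theorem xn34_130 : xbnCellAny2 34 (49/50 : ℚ) 1117632449024159 1145573260249762 (57/100 : ℚ) ((22077484557944 : ℤ), (31249381124971 : ℤ)) ((3374954367169074 : ℤ), (3467989626335604 : ℤ)) = true := by decide +kernel

set_option maxHeartbeats 4000000 in
/-- row D of cell 130 of `L = 34` (`aD = 79/1000`). [folklore] -/
theorem xd34_130 : xdCellAnyN0 34 (49/50 : ℚ) 1117632449024159 1145573260249762 (79/1000 : ℚ) ((22077484557944 : ℤ), (31249381124971 : ℤ)) = true := by decide +kernel

set_option maxHeartbeats 4000000 in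
/-- side condition of cell 130 of `L = 34` (`c, b = 117/100, aD`). [folklore] -/
theorem sd34_130 : sdCellAnyZN 34 (49/50 : ℚ) 100 1117632449024159 1145573260249762 ((57/100 : ℚ), (117 : ℕ), (79/1000 : ℚ)) ((22077484557944 : ℤ), (31249381124971 : ℤ)) = true := by decide +kernel

set_option maxHeartbeats 4000000 in
/-- row `N₁` of cell 131 of `L = 34` (`c = 57/100`), exporting `nt`, `tb`. [folklore] -/
theorem xn34_131 : xbnCellAny2 34 (49/50 : ℚ) 1145573260249762 1174212591756007 (57/100 : ℚ) ((23628376674205 : ℤ), (33470066081494 : ℤ)) ((3460327181350610 : ℤ), (3556128817422396 : ℤ)) = true := by decide +kernel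

set_option maxHeartbeats 4000000 in
/-- row D of cell 131 of `L = 34` (`aD = 79/1000`). [folklore] -/
theorem xd34_131 : xdCellAnyN0 34 (49/50 : ℚ) 1145573260249762 1174212591756007 (79/1000 : ℚ) ((23628376674205 : ℤ), (33470066081494 : ℤ)) = true := by decide +kernel

set_option maxHeartbeats 4000000 in
/-- side condition of cell 131 of `L = 34` (`c, b = 119/100, aD`). [folklore] -/
theorem sd34_131 : sdCellAnyZN 34 (49/50 : ℚ) 100 1145573260249762 1174212591756007 ((57/100 : ℚ), (119 : ℕ), (79/1000 : ℚ)) ((23628376674205 : ℤ), (33470066081494 : ℤ)) = true := by decide +kernel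

end FinXD

end Summit.HubbardSuperconductivity.HubbardSuperconductivity.Theorems.AnisotropyChord.Transfer.Fibre3
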